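import Mathlib
import Summits.Ventures.HodgeRepro2.T5HaarCosetIntegral
import Summits.Ventures.HodgeRepro2.T5HeckeDoubleCoset

/-!
# The Hecke operator as a Haar integral: `π(1_{KgK}) v = ∫_{KgK} π(y) v dy = vol(K) · T_g v`

The printed definition of the Hecke operator attached to a double coset is the Bochner integral
`π(1_{KgK}) v = ∫_G 1_{KgK}(y) π(y) v dμ(y)`.  For `v ∈ π^K` the integrand is constant on the
left cosets `xK`, so the integral is `μ(K)` times the finite sum `Σ_{xK ∈ KgK/K} π(x) v`
(`integral_indicator_doubleCosetSet_smul`), which is the Haar-free double-coset operator `T_g` of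
`T5HeckeDoubleCoset` (`integral_indicator_doubleCosetSet_smul_eq_heckeSMul`); with the
normalisation `vol(K) = 1` the two agree on the nose.  Here `π` is a representation of `G` on a
complete complex normed space `E` (no continuity assumption is needed: for `v ∈ π^K` the integrand
factors through the discrete set `G/K`).
-/

namespace Summit.Ventures.HodgeRepro2.T5HaarHeckeAction

open MeasureTheory T5HaarDoubleCosetVolume T5HaarCosetIntegral T5HeckePermutationModule
  T5HeckeDoubleCoset LevelPositivity

section VectorValued

variable {G : Type*} [Group G] [MeasurableSpace G] [MeasurableMul G]
  {E : Type*} [NormedAddCommGroup E] [NormedSpace ℝ E] [CompleteSpace E]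
  (μ : Measure G) [μ.IsMulLeftInvariant]

omit [MeasurableSpace G] [MeasurableMul G] [NormedSpace ℝ E] [CompleteSpace E] in
/-- A vector-valued function `F ∘ mk` on `G` with `F` supported in a finite set `S ⊆ G/K` is the
finite sum of the constants `F q` on the fibres `mk⁻¹{q}`, `q ∈ S`. -/
theorem comp_mk_eq_sum_indicator' {K : Subgroup G} (F : G ⧸ K → E) {S : Finset (G ⧸ K)}
    (hS : Function.support F ⊆ S) (y : G) :
    F (QuotientGroup.mk y) =
      ∑ q ∈ S, ((QuotientGroup.mk : G → G ⧸ K) ⁻¹' {q}).indicator (fun _ => F q) y := by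
  classical
  have h : ∀ q ∈ S, ((QuotientGroup.mk : G → G ⧸ K) ⁻¹' {q}).indicator (fun _ => F q) y =
      if q = QuotientGroup.mk y then F q else 0 := by
    intro q _
    rw [Set.indicator_apply]
    simp only [Set.mem_preimage, Set.mem_singleton_iff]
    by_cases hq : (QuotientGroup.mk y : G ⧸ K) = q
    · rw [if_pos hq, if_pos hq.symm]
    · rw [if_neg hq, if_neg (Ne.symm hq)]
  rw [Finset.sum_congr rfl h, Finset.sum_ite_eq']
  by_cases hy : (QuotientGroup.mk y : G ⧸ K) ∈ S
  · rw [if_pos hy]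
  · rw [if_neg hy]
    exact Function.support_subset_iff'.1 hS _ hy

omit [NormedSpace ℝ E] [CompleteSpace E] in
/-- Each vector-valued term `F q · 1_{mk⁻¹{q}}` is integrable (`K` measurable of finite measure). -/
theorem integrable_indicator_preimage_mk' {K : Subgroup G} (hK : MeasurableSet (K : Set G))
    (hμ : μ K ≠ ⊤) (e : E) (q : G ⧸ K) :
    Integrable (((QuotientGroup.mk : G → G ⧸ K) ⁻¹' {q}).indicator fun _ => e) μ := by
  rw [integrable_indicator_iff (measurableSet_preimage_mk_singleton hK q)]
  refine integrableOn_const ?_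
  rw [measure_preimage_mk_singleton μ K q]
  exact hμ

/-- THE HAAR INTEGRAL OF A VECTOR-VALUED `K`-INVARIANT FUNCTION IS A SUM OVER `G/K`:
`∫_G F(mk y) dμ(y) = μ(K) • Σ_{q ∈ S} F q`. -/
theorem integral_comp_mk' {K : Subgroup G} (hK : MeasurableSet (K : Set G)) (hμ : μ K ≠ ⊤)
    (F : G ⧸ K → E) {S : Finset (G ⧸ K)} (hS : Function.support F ⊆ S) :
    ∫ y, F (QuotientGroup.mk y) ∂μ = μ.real K • ∑ q ∈ S, F q := by
  have h : ∀ y : G, F (QuotientGroup.mk y) =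
      ∑ q ∈ S, ((QuotientGroup.mk : G → G ⧸ K) ⁻¹' {q}).indicator (fun _ => F q) y :=
    comp_mk_eq_sum_indicator' F hS
  simp only [h]
  rw [integral_finsetSum S fun q _ => integrable_indicator_preimage_mk' μ hK hμ (F q) q,
    Finset.smul_sum]
  refine Finset.sum_congr rfl fun q _ => ?_
  rw [integral_indicator_const (F q) (measurableSet_preimage_mk_singleton hK q), measureReal_def,
    measure_preimage_mk_singleton μ K q, measureReal_def]

end VectorValued

section HeckeAction

variable {G : Type*} [Group G] [MeasurableSpace G] [MeasurableMul G]
  {E : Type*} [NormedAddCommGroup E] [NormedSpace ℂ E] [CompleteSpace E]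
  (μ : Measure G) [μ.IsMulLeftInvariant] (ρ : Representation ℂ G E) {K : Subgroup G}

omit [MeasurableSpace G] [MeasurableMul G] [CompleteSpace E] in
/-- For `v ∈ π^K` the function `y ↦ 1_{KgK}(y) • π(y) v` factors through `G/K`. -/
theorem indicator_smul_apply_eq {v : E} (hv : v ∈ invariants ρ K) (g y : G) :
    (doubleCosetSet K g).indicator (fun _ => (1 : ℝ)) y • ρ y v =
      (MulAction.orbit K (g : G ⧸ K)).indicator (fun _ => (1 : ℝ)) (QuotientGroup.mk y) •
        orbitMap ρ v hv (QuotientGroup.mk y) := by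
  rw [orbitMap_mk]
  rfl

/-- THE HECKE OPERATOR AS A HAAR INTEGRAL: for `v ∈ π^K` and `K` measurable of finite measure,
`∫_G 1_{KgK}(y) • π(y) v dμ(y) = μ(K) • Σ_{xK ∈ KgK/K} π(x) v`. -/
theorem integral_indicator_doubleCosetSet_smul (hK : MeasurableSet (K : Set G)) (hμ : μ K ≠ ⊤)
    (g : G) [Finite (MulAction.orbit K (g : G ⧸ K))] {v : E} (hv : v ∈ invariants ρ K) :
    ∫ y, (doubleCosetSet K g).indicator (fun _ => (1 : ℝ)) y • ρ y v ∂μ =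
      μ.real K • ∑ᶠ (x : G ⧸ K) (_ : x ∈ MulAction.orbit K (g : G ⧸ K)), orbitMap ρ v hv x := by
  classical
  have hO : (MulAction.orbit K (g : G ⧸ K)).Finite := Set.toFinite _
  simp only [indicator_smul_apply_eq ρ hv g]
  rw [integral_comp_mk' μ hK hμ
    (fun q => (MulAction.orbit K (g : G ⧸ K)).indicator (fun _ => (1 : ℝ)) q • orbitMap ρ v hv q)
    (S := hO.toFinset) ?_, finsum_mem_eq_finite_toFinset_sum _ hO]
  · congr 1
    refine Finset.sum_congr rfl fun q hq => ?_
    rw [Set.Finite.mem_toFinset] at hq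
    rw [Set.indicator_of_mem hq, one_smul]
  · intro q hq
    rw [Function.mem_support] at hq
    rw [Finset.mem_coe, Set.Finite.mem_toFinset]
    by_contra hc
    apply hq
    rw [Set.indicator_of_notMem hc, zero_smul]

/-- `π(1_{KgK}) v = μ(K) • (T_g • v)`: the Haar integral of `1_{KgK}` against `π` on `π^K` is
`vol(K)` times the double-coset operator of `T5HeckeDoubleCoset`. -/
theorem integral_indicator_doubleCosetSet_smul_eq_heckeSMul (hK : MeasurableSet (K : Set G))
    (hμ : μ K ≠ ⊤) (g : G) [Finite (MulAction.orbit K (g : G ⧸ K))] (v : invariants ρ K) :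
    ∫ y, (doubleCosetSet K g).indicator (fun _ => (1 : ℝ)) y • ρ y v ∂μ =
      μ.real K • (heckeSMul ρ (doubleCosetOp ℂ K g) v : E) := by
  rw [integral_indicator_doubleCosetSet_smul μ ρ hK hμ g v.2, heckeSMul_doubleCosetOp]

/-- With the normalisation `vol(K) = 1`: `π(1_{KgK}) v = T_g • v` on `π^K`. -/
theorem integral_indicator_doubleCosetSet_smul_of_measure_eq_one (hK : MeasurableSet (K : Set G))
    (hμ : μ K = 1) (g : G) [Finite (MulAction.orbit K (g : G ⧸ K))] (v : invariants ρ K) :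
    ∫ y, (doubleCosetSet K g).indicator (fun _ => (1 : ℝ)) y • ρ y v ∂μ =
      (heckeSMul ρ (doubleCosetOp ℂ K g) v : E) := by
  rw [integral_indicator_doubleCosetSet_smul_eq_heckeSMul μ ρ hK (by rw [hμ]; exact ENNReal.one_ne_top),
    measureReal_def, hμ, ENNReal.toReal_one, one_smul]

end HeckeAction

end Summit.Ventures.HodgeRepro2.T5HaarHeckeAction
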